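import Summits.ResolutionOfSingularities.ResolutionOfSingularities.Theorems.FrobeniusLadderFRationalModificationFiniteBlowupRungThreeOrCertifiedDefectModel
import Summits.ResolutionOfSingularities.ResolutionOfSingularities.Theorems.FrobeniusLadderFRationalModificationIntegralForm
import Summits.ResolutionOfSingularities.ResolutionOfSingularities.Theorems.FrobeniusLadderFRationalResolutionFRationalLocalizesScheme
import Summits.ResolutionOfSingularities.ResolutionOfSingularities.Theorems.FrobeniusLadderFInjectiveMacaulayficationBadPointsClosed
import Literature.AlgebraicGeometry.Resolution.StalkSpecializesLocalization
import Literature.AlgebraicGeometry.Dimension.FibreLocalRingDimension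
import Mathlib.AlgebraicGeometry.Morphisms.Proper
import Mathlib.AlgebraicGeometry.Noetherian
import HarnessLib

/-!
# Finite defect ⇒ rung-3 model, from local blow-up certificates at isolated-defect germs

Support file for crux stmt-ResolutionOfSingularities-15316 (`FrobeniusLadder.FRationalModification`, route
`ResolutionOfSingularities/FrobeniusLadder`), line `socle-discrepancy-certificate`, lead a1 (crux cycle 10): the
PROVABLE HALF of the registered globalisation stub `stub_codimStep` (v2L), with the two inputs that v2L's local
hypothesis had to be fed — closedness of the defect points and rung 3 on the punctured spectrum — DERIVED here
instead of assumed. This is the theorem the reshaped skeleton v3 composes with its open residue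
`stub_isolateDefect` (isolate the defect by a rung-2-preserving modification) and with the local producers in
blow-up form (`∃ I 𝔪-primary, affineBlowup I pointwise rung-3 ∨ certified`).

Let `Y` be an integral separated `k`-scheme of finite type (`char k = p`) and call DEFECT the set `D` of
points whose local ring fails the rung-3 clause (domain; every ideal generated by a system of parameters
tightly closed, inline form).

* §1 `isClosed_singleton_of_finite_defect` — if `D` is finite, every point of `D` is CLOSED: the rung-3
  clause passes to generizations (`FRationalResolution.fRationalClause_of_specializes`, HH94 4.2 (f) +
  Stacks 01J7), so `D` is stable under specialization, and a finite specialization-stable set of a Jacobson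
  space consists of closed points (`BadPointsClosed.isClosed_singleton_of_stableUnderSpecialization_finite`).
* §2 `rungThree_localization_of_finite_defect` — if `D` is finite and `x ∈ D`, then EVERY localization of
  `𝒪_{Y,x}` at a non-maximal prime satisfies the rung-3 clause (the defect is isolated in `Spec 𝒪_{Y,x}`):
  a prime `q ≠ 𝔪` of `𝒪_{Y,x}` is the contraction of `𝔪_{x'}` for a generization `x' ⤳ x`
  (`exists_specializes_comap_stalkSpecializes_eq`), `x' ≠ x` is not closed hence not in `D`, and
  `(𝒪_{Y,x})_q ≅ 𝒪_{Y,x'}` (`isLocalizationAtPrime_stalkSpecializes` + `IsLocalization.algEquiv`).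
* §3 `ringKrullDim_stalk_eq_of_isClosed` — at a closed point `dim 𝒪_{Y,x} = dim Y`
  (`coheight_add_height_eq_topologicalKrullDim`, height of a closed point is `0`).
* §4 `rungThreeModel_of_finiteDefect` — THE FINITE-DEFECT GLOBALISER: if the defect is finite and at every
  defect point of dimension `≥ 2` with rung-3 punctured spectrum some `𝔪`-primary ideal `I` of the stalk has
  `affineBlowup I` pointwise rung-3-or-certified, then `Y` has a proper birational model with rung-3 stalks:
  curves are settled by normalisation (`IntegralForm.rungThreeModel_of_dim_le_one`); otherwise every defect
  point is a closed point of dimension `dim Y ≥ 2` (§1, §3) with rung-3 punctured spectrum (§2) — the two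
  guards are discharged, not assumed — and
  `FiniteBlowupRungThreeOrCertifiedDefectModel.finiteBlowupRungThreeOrCertifiedDefect_model` (p157821) glues
  and consumes the local blow-up certificates.

References: M. Hochster, C. Huneke, Trans. AMS 346 (1994), Thm. 4.2 (f); The Stacks Project, Tag 01J7;
U. Görtz, T. Wedhorn, *Algebraic Geometry I* (2nd ed.), Thm. 5.22, Prop. 13.91. [folklore]
-/

-- single-problem summit: the doubled namespace component `ResolutionOfSingularities` is forced
set_option linter.dupNamespace false

noncomputable section

open CategoryTheory AlgebraicGeometry TopologicalSpace IsLocalRing Order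
open Literature.AlgebraicGeometry.Resolution Literature.RingTheory.TightClosure
open Summit.ResolutionOfSingularities.ResolutionOfSingularities.Theorems
open Summit.ResolutionOfSingularities.ResolutionOfSingularities.Theorems.FRationalModification

namespace Summit.ResolutionOfSingularities.ResolutionOfSingularities.Theorems.FRationalModification.FiniteDefectGlobal

/-- The rung-3 clause of the crux at a ring `X` (domain; every ideal generated by a system of parameters
tightly closed — inline form). -/
local notation3 "RUNG3[" p ", " X "]" => IsDomain X ∧ ∀ d : ℕ, ringKrullDim X = (d : WithBot ℕ∞) →
  ∀ s : Fin d → X, (Ideal.radical (R := X) (Ideal.span (Set.range s))).IsMaximal → ∀ y c : X, c ≠ 0 →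
    (∀ e : ℕ, c * y ^ p ^ e ∈ Ideal.span ((fun z : X => z ^ p ^ e) '' (Ideal.span (Set.range s) : Set X))) →
      y ∈ Ideal.span (Set.range s)

/-- The Cohen–Macaulay + Frobenius-closed clause (rung 2 without the domain conjunct) at a ring `X`. -/
local notation3 "CLAUSE[" p ", " X "]" => ∀ d : ℕ, ringKrullDim X = (d : WithBot ℕ∞) → ∀ s : Fin d → X,
  (Ideal.radical (R := X) (Ideal.span (Set.range s))).IsMaximal →
    RingTheory.Sequence.IsWeaklyRegular X (List.ofFn s) ∧
    ∀ y : X, (∃ e : ℕ, y ^ p ^ e ∈ Ideal.span ((fun z : X => z ^ p ^ e) '' (Ideal.span (Set.range s) : Set X))) →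
      y ∈ Ideal.span (Set.range s)

/-- The pointwise certificate at a local ring `L`: a domain with a non-zero `t ∈ 𝔪_L`, `L[1/t]` regular and
`L/(t)` Cohen–Macaulay with Frobenius-closed parameter ideals (inline form). -/
local notation3 "CERT[" p ", " L "]" => IsDomain L ∧ ∃ t : L,
  t ∈ IsLocalRing.maximalIdeal L ∧ t ≠ 0 ∧ IsRegularRing (Localization.Away t) ∧ CLAUSE[p, L ⧸ Ideal.span {t}]

/-! ## §1 A finite defect consists of closed points -/

/-- **The defect is stable under specialization**: if `x ⤳ y` and the stalk at `x` fails the rung-3 clause,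
so does the stalk at `y` (contrapositive of `fRationalClause_of_specializes`: F-rationality localizes,
HH94 Thm. 4.2 (f), and the stalk at a generization is a localization, Stacks 01J7).
[cite: HochsterHuneke1994, Thm. 4.2 (f)] -/
theorem stableUnderSpecialization_defect (p : ℕ) [Fact p.Prime] (k : Type) [Field k] [CharP k p]
    (Y : Scheme.{0}) (g : Y ⟶ Spec (.of k)) [LocallyOfFiniteType g] :
    StableUnderSpecialization {x : Y | ¬ RUNG3[p, Y.presheaf.stalk x]} := by
  intro x y hxy hx hy
  exact hx (FRationalResolution.fRationalClause_of_specializes p Fact.out k Y g hxy hy)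

/-- **§1 — a finite defect consists of closed points.** For `Y` locally of finite type over a field of
characteristic `p`: if the set of points whose stalk fails the rung-3 clause is finite, each of its points is
closed (Jacobson space + specialization-stability). [cite: HochsterHuneke1994, Thm. 4.2 (f)] -/
theorem isClosed_singleton_of_finite_defect (p : ℕ) [Fact p.Prime] (k : Type) [Field k] [CharP k p]
    (Y : Scheme.{0}) (g : Y ⟶ Spec (.of k)) [LocallyOfFiniteType g]
    (hfin : {x : Y | ¬ RUNG3[p, Y.presheaf.stalk x]}.Finite) {x : Y}
    (hx : ¬ RUNG3[p, Y.presheaf.stalk x]) : IsClosed ({x} : Set Y) := by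
  haveI : JacobsonSpace Y := LocallyOfFiniteType.jacobsonSpace g
  exact FInjectiveMacaulayfication.BadPointsClosed.isClosed_singleton_of_stableUnderSpecialization_finite
    hfin (stableUnderSpecialization_defect p k Y g) hx

/-! ## §2 At a point of a finite defect the punctured spectrum is rung-3 -/

/-- **§2 — with finite defect, every punctured local spectrum is rung-3.** For `Y` locally of finite type
over a field of characteristic `p` with FINITE defect and ANY point `x`, the localization of `𝒪_{Y,x}` at
every non-maximal prime `q` satisfies the rung-3 clause (so a defect point is an isolated-defect germ): `q` is
the contraction of `𝔪_{x'}` for a generization `x' ⤳ x` (Stacks 01J7); were `x'` in the defect it would be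
closed (§1), forcing `x = x'` and `q = 𝔪`; and `(𝒪_{Y,x})_q ≅ 𝒪_{Y,x'}` transports the clause.
[cite: StacksProject, Tag 01J7; HochsterHuneke1994, Thm. 4.2 (f)] -/
theorem rungThree_localization_of_finite_defect (p : ℕ) [Fact p.Prime] (k : Type) [Field k] [CharP k p]
    (Y : Scheme.{0}) (g : Y ⟶ Spec (.of k)) [LocallyOfFiniteType g]
    (hfin : {x : Y | ¬ RUNG3[p, Y.presheaf.stalk x]}.Finite) (x : Y)
    (q : Ideal (Y.presheaf.stalk x)) [q.IsPrime]
    (hq : q ≠ maximalIdeal (Y.presheaf.stalk x)) : RUNG3[p, Localization.AtPrime q] := by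
  obtain ⟨x', hx'x, rfl⟩ := exists_specializes_comap_stalkSpecializes_eq x q
  -- `x'` is not in the defect: otherwise it would be closed, hence equal to `x`, and `q = 𝔪`
  have hx' : RUNG3[p, Y.presheaf.stalk x'] := by
    by_contra hx'
    have hcl : IsClosed ({x'} : Set Y) := isClosed_singleton_of_finite_defect p k Y g hfin hx'
    have hxx' : x ∈ ({x'} : Set Y) := by
      rw [← hcl.closure_eq]
      exact specializes_iff_mem_closure.mp hx'x
    rw [Set.mem_singleton_iff] at hxx'
    subst hxx'
    apply hq
    rw [TopCat.Presheaf.stalkSpecializes_refl]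
    exact Ideal.comap_id _
  -- `(𝒪_{Y,x})_q ≅ 𝒪_{Y,x'}`
  letI := (Y.presheaf.stalkSpecializes hx'x).hom.toAlgebra
  haveI := isLocalizationAtPrime_stalkSpecializes hx'x
  set P := (maximalIdeal (Y.presheaf.stalk x')).comap (Y.presheaf.stalkSpecializes hx'x).hom with hP
  let e : Localization.AtPrime P ≃ₐ[Y.presheaf.stalk x] Y.presheaf.stalk x' :=
    IsLocalization.algEquiv P.primeCompl (Localization.AtPrime P) (Y.presheaf.stalk x')
  exact FRationalResolution.ClauseInvariance.stub_clause_of_ringEquiv p e.toRingEquiv.symm hx'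

/-! ## §3 The dimension of the local ring at a closed point -/

/-- **§3 — `dim 𝒪_{Y,x} = dim Y` at a closed point** of an integral scheme locally of finite type over a
field (`dim 𝒪_{Y,x} + dim closure {x} = dim Y`, `coheight_add_height_eq_topologicalKrullDim`, and the
closure of a closed point is the point). [cite: GortzWedhorn2020, Thm. 5.22] -/
theorem ringKrullDim_stalk_eq_of_isClosed {k : Type} [Field k] (Y : Scheme.{0}) [IsIntegral Y]
    (g : Y ⟶ Spec (.of k)) [LocallyOfFiniteType g] {x : Y} (hx : IsClosed ({x} : Set Y)) :
    ringKrullDim (Y.presheaf.stalk x) = topologicalKrullDim Y := by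
  have h := Literature.AlgebraicGeometry.Dimension.coheight_add_height_eq_topologicalKrullDim g x
  have h0 : height x = 0 := by
    rw [height_eq_zero]
    intro y hy
    -- `y ≤ x` means `x ⤳ y`, i.e. `y ∈ closure {x} = {x}`
    have hyx : y ∈ ({x} : Set Y) := by
      rw [← hx.closure_eq]
      exact specializes_iff_mem_closure.mp (Scheme.le_iff_specializes.mp hy)
    rw [Set.mem_singleton_iff] at hyx
    exact hyx ▸ le_rfl
  rw [h0, add_zero] at h
  rw [ringKrullDim_stalk_eq_coheight x]
  exact h

/-- `¬ d ≤ 1 ⇒ 2 ≤ d` in `WithBot ℕ∞`. -/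
theorem two_le_of_not_le_one {d : WithBot ℕ∞} (h : ¬ d ≤ 1) : (2 : WithBot ℕ∞) ≤ d := by
  induction d using WithBot.recBotCoe with
  | bot => exact absurd bot_le h
  | coe e =>
    induction e using ENat.recTopCoe with
    | top => exact_mod_cast le_top
    | coe n =>
      have h' : ¬ n ≤ 1 := fun hn => h (by exact_mod_cast hn)
      have h2 : 2 ≤ n := by omega
      have h3 : (2 : ℕ∞) ≤ n := by exact_mod_cast h2
      have h4 : ((2 : ℕ∞) : WithBot ℕ∞) ≤ ((n : ℕ∞) : WithBot ℕ∞) := WithBot.coe_le_coe.mpr h3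
      exact h4

/-! ## §4 The finite-defect globaliser -/

/-- **§4 — FINITE DEFECT ⇒ RUNG-3 MODEL, from local blow-up certificates at the defect points** (the
provable half of v2L's `stub_codimStep`, lead a1). Let `Y/k` be integral, separated, of finite type
(`char k = p`) with FINITE defect, and suppose that at every defect point `x` whose local ring has dimension `≥ 2`
and rung-3 punctured spectrum some `𝔪_x`-primary ideal `I ⊆ 𝒪_{Y,x}` has a blowing up `affineBlowup I` that is
pointwise rung-3 OR certified (domain with `t ∈ 𝔪 ∖ 0`, `𝒪[1/t]` regular, `𝒪/(t)` Cohen–Macaulay with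
Frobenius-closed parameter ideals). Then `Y` has a proper birational model all of whose stalks are rung-3.
Curves: normalisation (`IntegralForm.rungThreeModel_of_dim_le_one`). Otherwise the defect points are closed
(§1) of dimension `dim Y ≥ 2` (§3) with rung-3 punctured spectra (§2) — so the two guards of the local hypothesis
are DISCHARGED here, not assumed — and `finiteBlowupRungThreeOrCertifiedDefect_model` (p157821) glues and
consumes the local blow-up certificates.
[cite: HochsterHuneke1994, Thm. 4.2 (f); GortzWedhorn2020, Prop. 13.91; StacksProject, Tag 01J7] -/
theorem rungThreeModel_of_finiteDefect
    (p : ℕ) [Fact p.Prime] (k : Type) [Field k] [CharP k p] (Y : Scheme.{0}) (g : Y ⟶ Spec (.of k))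
    [IsSeparated g] [LocallyOfFiniteType g] [QuasiCompact g] [IsIntegral Y] (hfin : {x : Y | ¬ (IsDomain
    (Y.presheaf.stalk x) ∧ ∀ d : ℕ, ringKrullDim (Y.presheaf.stalk x) = d → ∀ s : Fin d → (Y.presheaf.stalk
    x), (Ideal.span (Set.range s)).radical.IsMaximal → ∀ u c : (Y.presheaf.stalk x), c ≠ 0 → (∀ e : ℕ, c * u
    ^ p ^ e ∈ Ideal.span ((fun z : (Y.presheaf.stalk x) => z ^ p ^ e) '' (Ideal.span (Set.range s) : Set
    (Y.presheaf.stalk x)))) → u ∈ Ideal.span (Set.range s))}.Finite) (hloc : ∀ x : Y, ¬ (IsDomain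
    (Y.presheaf.stalk x) ∧ ∀ d : ℕ, ringKrullDim (Y.presheaf.stalk x) = d → ∀ s : Fin d → (Y.presheaf.stalk
    x), (Ideal.span (Set.range s)).radical.IsMaximal → ∀ u c : (Y.presheaf.stalk x), c ≠ 0 → (∀ e : ℕ, c * u
    ^ p ^ e ∈ Ideal.span ((fun z : (Y.presheaf.stalk x) => z ^ p ^ e) '' (Ideal.span (Set.range s) : Set
    (Y.presheaf.stalk x)))) → u ∈ Ideal.span (Set.range s)) → (2 : WithBot ℕ∞) ≤ ringKrullDim
    (Y.presheaf.stalk x) → (∀ (q : Ideal (Y.presheaf.stalk x)) [q.IsPrime], q ≠ IsLocalRing.maximalIdeal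
    (Y.presheaf.stalk x) → (IsDomain (Localization.AtPrime q) ∧ ∀ d : ℕ, ringKrullDim (Localization.AtPrime
    q) = d → ∀ s : Fin d → (Localization.AtPrime q), (Ideal.span (Set.range s)).radical.IsMaximal → ∀ u c :
    (Localization.AtPrime q), c ≠ 0 → (∀ e : ℕ, c * u ^ p ^ e ∈ Ideal.span ((fun z : (Localization.AtPrime
    q) => z ^ p ^ e) '' (Ideal.span (Set.range s) : Set (Localization.AtPrime q)))) → u ∈ Ideal.span
    (Set.range s))) → (∃ I : Ideal (Y.presheaf.stalk x), I ≤ IsLocalRing.maximalIdeal (Y.presheaf.stalk x) ∧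
    IsLocalRing.maximalIdeal (Y.presheaf.stalk x) ≤ I.radical ∧ ∀ w : affineBlowup I, (IsDomain
    ((affineBlowup I).presheaf.stalk w) ∧ ∀ d : ℕ, ringKrullDim ((affineBlowup I).presheaf.stalk w) = d → ∀
    s : Fin d → ((affineBlowup I).presheaf.stalk w), (Ideal.span (Set.range s)).radical.IsMaximal → ∀ u c :
    ((affineBlowup I).presheaf.stalk w), c ≠ 0 → (∀ e : ℕ, c * u ^ p ^ e ∈ Ideal.span ((fun z :
    ((affineBlowup I).presheaf.stalk w) => z ^ p ^ e) '' (Ideal.span (Set.range s) : Set ((affineBlowup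
    I).presheaf.stalk w)))) → u ∈ Ideal.span (Set.range s)) ∨ (IsDomain (((affineBlowup I).presheaf.stalk
    w)) ∧ ∃ t : ((affineBlowup I).presheaf.stalk w), t ∈ IsLocalRing.maximalIdeal (((affineBlowup
    I).presheaf.stalk w)) ∧ t ≠ 0 ∧ IsRegularRing (Localization.Away t) ∧ (∀ d : ℕ, ringKrullDim
    (((affineBlowup I).presheaf.stalk w) ⧸ Ideal.span {t}) = d → ∀ s : Fin d → ((affineBlowup
    I).presheaf.stalk w) ⧸ Ideal.span {t}, (Ideal.span (Set.range s)).radical.IsMaximal →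
    RingTheory.Sequence.IsWeaklyRegular (((affineBlowup I).presheaf.stalk w) ⧸ Ideal.span {t}) (List.ofFn s)
    ∧ ∀ u : ((affineBlowup I).presheaf.stalk w) ⧸ Ideal.span {t}, (∃ e : ℕ, u ^ p ^ e ∈ Ideal.span ((fun z :
    ((affineBlowup I).presheaf.stalk w) ⧸ Ideal.span {t} => z ^ p ^ e) '' (Ideal.span (Set.range s) : Set
    (((affineBlowup I).presheaf.stalk w) ⧸ Ideal.span {t})))) → u ∈ Ideal.span (Set.range s))))) : ∃ (Y₂ :
    Scheme.{0}) (π : Y₂ ⟶ Y), IsProper π ∧ IsBirational π ∧ ∀ x : Y₂, (IsDomain (Y₂.presheaf.stalk x) ∧ ∀ d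
    : ℕ, ringKrullDim (Y₂.presheaf.stalk x) = d → ∀ s : Fin d → (Y₂.presheaf.stalk x), (Ideal.span
    (Set.range s)).radical.IsMaximal → ∀ u c : (Y₂.presheaf.stalk x), c ≠ 0 → (∀ e : ℕ, c * u ^ p ^ e ∈
    Ideal.span ((fun z : (Y₂.presheaf.stalk x) => z ^ p ^ e) '' (Ideal.span (Set.range s) : Set
    (Y₂.presheaf.stalk x)))) → u ∈ Ideal.span (Set.range s)) := by
  classical
  have hp : p.Prime := Fact.out
  haveI : IsLocallyNoetherian Y := LocallyOfFiniteType.isLocallyNoetherian g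
  by_cases hdim : topologicalKrullDim Y ≤ 1
  · -- curves (and points): the normalisation is a resolution, hence a rung-3 model
    exact IntegralForm.rungThreeModel_of_dim_le_one hp k Y g hdim
  -- the defect `T`: finite, closed points, and `hdef` by definition
  set T : Set Y := {x : Y | ¬ RUNG3[p, Y.presheaf.stalk x]} with hT
  have hTc : ∀ x ∈ T, IsClosed ({x} : Set Y) := fun x hx =>
    isClosed_singleton_of_finite_defect p k Y g hfin hx
  refine FiniteBlowupRungThreeOrCertifiedDefectModel.finiteBlowupRungThreeOrCertifiedDefect_model p k Y g T
    hfin hTc (fun x => Iff.rfl) fun x hx => ?_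
  -- the local blow-up certificate at `x ∈ T`: the two guards of `hloc` hold at `x`
  have hdim2 : (2 : WithBot ℕ∞) ≤ ringKrullDim (Y.presheaf.stalk x) := by
    rw [ringKrullDim_stalk_eq_of_isClosed Y g (hTc x hx)]
    exact two_le_of_not_le_one hdim
  exact hloc x hx hdim2 (fun q _ hq => rungThree_localization_of_finite_defect p k Y g hfin x q hq)

end Summit.ResolutionOfSingularities.ResolutionOfSingularities.Theorems.FRationalModification.FiniteDefectGlobal

end
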